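import Summits.BirchSwinnertonDyer.Rank1Residual.Additive.KatoDescentIntegralH1RankOne
import Literature.NumberTheory.EllipticCurves.Kato2004.LocalIndexSkeletonProofs
import HarnessLib

set_option autoImplicit false

/-!
# The index `[H¹(ℤ[1/p], T_pW) : ℤ_p·y]` through the Kummer-logarithm functional, and conjunct (ii) of the display
# COUNT (7) of stub 3 `stub_rankOneCountReadingKato` PROVED on descent packages (seat `bsd-cm-prr-ty1` g9, cell
# `bsd-cm`; theorems only: no definition, no named fact, no instance, no `sorry`)

Part 9 of the seat's kernel cut of stub 3 of the Kato–Perrin-Riou skeletons v4 (cruxes stmt-BirchSwinnertonDyer-19945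
`…/Lines/kato_perrin_riou_zp.lean`, stmt-BirchSwinnertonDyer-19223 `…/Lines/kato_perrin_riou_istar.lean`; = cell bsd-potss's
held input 27322). After `KatoDescentIntegralH1RankOne.lean` (part 8: (R1) `rank_{ℤ_p} A ≤ 1` for
`A = H¹(ℤ[1/p], T_pW) = integralH1 (tateRep W p) p (κ.layerSubgroup 0)`, the `ℤ_p`-linear Kummer-logarithm functional
`φ : A → ℚ_p` with torsion kernel) the residual of stub 3 is {GZK, `IsNewformOf.level_eq_conductorNorm`} + the displays
PR-INV (6) and COUNT (7). COUNT speaks of the index `[J.A : Λ·J.ι[x]]` of the class of `x ∈ 𝐇¹_Γ` in Kato's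
`A = H¹(ℤ[1/p], T_pW)` and of the Kummer logarithm `s` of `proj₀ x`. THIS FILE computes that index through `φ`:

* §1 (pure `ℤ_p`-algebra; `A` any `ℤ_p`-module, `φ : A →ₗ[ℤ_p] ℚ_p`): `ℤ_p·y ∩ ker φ = 0` when `φ y ≠ 0`;
  `φ⁻¹(ℤ_p·φ y) = ℤ_p·y + ker φ`; hence, when `φ(A) = p^{v₀}ℤ_p` (the shape of every non-zero finitely generated
  `ℤ_p`-submodule of `ℚ_p`, `LocalIndex.exists_eq_span_zpow_of_fg`),
  **`#(A / ℤ_p·y) = #ker φ · p^{v(φ y) − v₀}`** (`natCard_quotient_span_singleton_eq`: `[A : ℤ_p y + ker φ] =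
  [p^{v₀}ℤ_p : ℤ_p φ(y)]` by `LocalIndex.relIndex_span_singleton_span_zpow`, `[ℤ_p y + ker φ : ℤ_p y] = #ker φ`), and
  `#(A / ℤ_p·y) = 0` (infinite quotient) when `φ y = 0` but `φ ≠ 0` on `A`.
* §2 (descent packages): for `W/ℚ` globally minimal of rank `1` with `Ш[p^∞]` finite and a package
  `J : IwasawaH2Data W p κ γ I` over a pin with `𝐇¹_Γ = I.H` finitely generated, torsion free, non-zero (Kato (12.2.1),
  Thm. 12.4 (2)): the Kummer-log functional `φ` of part 8 is NON-ZERO on `A` ((α) on the package + cn100's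
  `IwasawaH1Data.exists_proj_zero_not_isOfFinAddOrder`), so `φ(A) = p^{v₀}ℤ_p` for a unique `v₀ ∈ ℤ`; its kernel is the
  (finite) torsion of `A`; the pin `A ≃ J.A` (`integralH1Equiv`, `toH1_ι`, `Λ` acting through the augmentation
  `toH1_smul`) carries `Λ·J.ι[x]` to `ℤ_p·proj₀ x`; whence **conjunct (ii) of COUNT**
  `s ≠ 0 ↔ [J.A : Λ·J.ι[x]] ≠ 0` for the Kummer logarithm `s` of `proj₀ x` (`count_ii_of_iwasawaH2Data`), and the
  INDEX FORMULA `[J.A : Λ·J.ι[x]] = #ker φ · p^{v(s) − v₀}` (`natCard_quotient_ι_eq`) that turns conjunct (iii) of COUNT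
  into the `x`-free, `s`-free Euler-characteristic identity
  «`v_p #𝐇²_Γ/T + v₀ − v_p #A_tors = v_p #Ш[p^∞] + v_p Tam(W) + 2·v_p log_ω(P)`» (part 10, `KatoDescentRankOneCountEC.lean`).

PRINT: Kato (14.9.3) ⊗ ℚ and §14.14 (the index `[M : z]` of Thm. 14.5 / 14.17 read in the coordinate `φ`, p. 237 /
p. 247); Bloch–Kato Ex. 3.11 (`log` on `H¹_f(ℚ_p, V)`); the rank-one bookkeeping «`H¹(G_S, T_pE) ≅ ℤ_p`, `𝔥 = H¹(ℤ[1/p],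
T_pE) = p^a ℤ_p κ(P)`» of cell bsd-potss's memo KMC-DESCENT-MEMO §4 (R1-a) (Kato (14.9.3), Greenberg LNM 1716 §3–4, Coates
LNM 1716 L. 3.8).

HONEST LABEL: theorems only; no stub or item is closed; nothing is registered; nothing is asserted on 19945 / 19223;
Kato's Main Conjecture and Perrin-Riou's conjecture are not touched; BSD is not proved for any curve.

References: [Kato2004Asterisque] §14.9 (14.9.3) (p. 240), §14.14 (14.14.1) (p. 243), Thm. 14.5 and the definition of
`[M : z]` (pp. 236–237), 14.17 (p. 247), Thm. 12.4 (2) (p. 221); [BlochKato1990] Def. 3.10, Ex. 3.11;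
[GreenbergLNM1716] §3–4; [SerreLocalFields1979] Ch. I §3 Prop. 5, Ch. II §3.
-/

noncomputable section

open scoped Classical NumberField

open WeierstrassCurve Field IsDedekindDomain Literature.NumberTheory.EllipticCurves
  Literature.NumberTheory.EllipticCurves.Kato2004 Literature.NumberTheory.EllipticCurves.IwasawaAlgebra
  Literature.NumberTheory.EllipticCurves.Kato2004.EulerSystemValues Literature.NumberTheory.GaloisRepresentations
  Literature.NumberTheory.EllipticCurves.ModularForms Literature.NumberTheory.EllipticCurves.Rank1Residual
  Literature.NumberTheory.EllipticCurves.Kato2004.LocalIndex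
open Summit.BirchSwinnertonDyer.BirchSwinnertonDyer.Theorems.CongruentShaFreeCutKatoDescentDatumOfH2
  Summit.BirchSwinnertonDyer.BirchSwinnertonDyer.Theorems.CongruentShaFreeCutKatoKummerLogTorsion

namespace Summit.BirchSwinnertonDyer.Rank1Residual.Additive.LocPKummer

/-! ## §1 Index calculus for a `ℤ_p`-linear functional `φ : A → ℚ_p` -/

section IndexCalculus

variable {p : ℕ} [Fact p.Prime] {A : Type*} [AddCommGroup A] [Module ℤ_[p] A] (φ : A →ₗ[ℤ_[p]] ℚ_[p])

/-- `ℚ_p` is torsion free over `ℤ_p`. [folklore] -/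
private theorem eq_zero_or_eq_zero_of_smul_eq_zero {c : ℤ_[p]} {t : ℚ_[p]} (h : c • t = 0) : c = 0 ∨ t = 0 := by
  rw [Algebra.smul_def, mul_eq_zero] at h
  rcases h with h | h
  · left
    exact IsFractionRing.injective ℤ_[p] ℚ_[p] (h.trans (map_zero _).symm)
  · exact Or.inr h

/-- In an element killed by a non-zero `p`-adic integer has finite additive order (`a = u·p^v`). [folklore] -/
private theorem isOfFinAddOrder_of_smul_eq_zero' {N : Type*} [AddCommGroup N] [Module ℤ_[p] N] {a : ℤ_[p]}
    (ha : a ≠ 0) {x : N} (hx : a • x = 0) : IsOfFinAddOrder x := by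
  have hp : p.Prime := Fact.out
  set u := PadicInt.unitCoeff ha
  have h1 : ((p : ℤ_[p]) ^ a.valuation) • x = 0 := by
    have e : (p : ℤ_[p]) ^ a.valuation = ((u⁻¹ : ℤ_[p]ˣ) : ℤ_[p]) * a := by
      conv_rhs => rw [PadicInt.unitCoeff_spec ha]
      rw [← mul_assoc, Units.inv_mul, one_mul]
    rw [e, mul_smul, hx, smul_zero]
  refine isOfFinAddOrder_iff_nsmul_eq_zero.mpr ⟨p ^ a.valuation, pow_pos hp.pos _, ?_⟩
  rw [← Nat.cast_smul_eq_nsmul ℤ_[p], Nat.cast_pow]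
  exact h1

/-- If `φ y ≠ 0` then `ℤ_p·y` meets `ker φ` trivially (`ℚ_p` is a domain). [folklore] -/
theorem span_singleton_inf_ker_eq_bot {y : A} (hy : φ y ≠ 0) : (ℤ_[p] ∙ y) ⊓ LinearMap.ker φ = ⊥ := by
  rw [eq_bot_iff]
  rintro a ⟨ha, hk⟩
  obtain ⟨c, rfl⟩ := Submodule.mem_span_singleton.mp ha
  have h0 : c • φ y = 0 := by
    rw [← map_smul]
    exact hk
  rcases eq_zero_or_eq_zero_of_smul_eq_zero h0 with hc | hc
  · rw [hc, zero_smul]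
    exact Submodule.zero_mem _
  · exact absurd hc hy

/-- `φ⁻¹(ℤ_p·φ y) = ℤ_p·y + ker φ`. [folklore] -/
theorem comap_span_singleton_eq (y : A) :
    (ℤ_[p] ∙ φ y).comap φ = (ℤ_[p] ∙ y) ⊔ LinearMap.ker φ := by
  ext a
  rw [Submodule.mem_comap, Submodule.mem_span_singleton, Submodule.mem_sup]
  constructor
  · rintro ⟨c, hc⟩
    refine ⟨c • y, Submodule.mem_span_singleton.mpr ⟨c, rfl⟩, a - c • y, ?_, add_sub_cancel _ _⟩
    rw [LinearMap.mem_ker, map_sub, map_smul, hc, sub_self]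
  · rintro ⟨b, hb, k, hk, rfl⟩
    obtain ⟨c, rfl⟩ := Submodule.mem_span_singleton.mp hb
    refine ⟨c, ?_⟩
    rw [map_add, map_smul, LinearMap.mem_ker.mp hk, add_zero]

/-- A non-zero element of `φ(A) = p^{v₀}ℤ_p` has valuation `≥ v₀`. [cite: SerreLocalFields1979, Ch. II §3 (ℤ_p)] -/
theorem le_valuation_of_range_eq {v₀ : ℤ} (hv₀ : LinearMap.range φ = Submodule.span ℤ_[p] {((p : ℚ_[p]) ^ v₀)})
    {y : A} (hy : φ y ≠ 0) : v₀ ≤ (φ y).valuation := by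
  have hmem : φ y ∈ Submodule.span ℤ_[p] {((p : ℚ_[p]) ^ v₀)} := hv₀ ▸ LinearMap.mem_range_self φ y
  have h := (Submodule.span_singleton_le_iff_mem _ _).mpr hmem
  rw [span_singleton_eq_span_zpow hy] at h
  exact span_zpow_le_iff.mp h

/-- **`[A : ℤ_p·y + ker φ] = p^{v(φ y) − v₀}`** when `φ(A) = p^{v₀}ℤ_p` and `φ y ≠ 0`: `A/(ℤ_p·y + ker φ) ≅ φ(A)/ℤ_p·φ(y)`.
[cite: Kato2004Asterisque, 14.17 (the index `[M : z]` in a rank-one coordinate, p. 247)] [cite: SerreLocalFields1979, Ch. II §3] -/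
theorem index_span_singleton_sup_ker {y : A} (hy : φ y ≠ 0) {v₀ : ℤ}
    (hv₀ : LinearMap.range φ = Submodule.span ℤ_[p] {((p : ℚ_[p]) ^ v₀)}) :
    ((ℤ_[p] ∙ y) ⊔ LinearMap.ker φ).toAddSubgroup.index = p ^ ((φ y).valuation - v₀).toNat := by
  have hmem : φ y ∈ Submodule.span ℤ_[p] {((p : ℚ_[p]) ^ v₀)} := hv₀ ▸ LinearMap.mem_range_self φ y
  have h1 : ((ℤ_[p] ∙ y) ⊔ LinearMap.ker φ).toAddSubgroup =
      ((ℤ_[p] ∙ φ y).toAddSubgroup).comap φ.toAddMonoidHom := by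
    rw [← comap_span_singleton_eq]
    rfl
  rw [h1, ← AddSubgroup.relIndex_top_right, AddSubgroup.relIndex_comap, ← AddMonoidHom.range_eq_map,
    ← LinearMap.range_toAddSubgroup, hv₀]
  exact relIndex_span_singleton_span_zpow hy hmem

/-- **`[ℤ_p·y + ker φ : ℤ_p·y] = #ker φ`** when `φ y ≠ 0` (the two subgroups meet trivially). [folklore] -/
theorem relIndex_span_singleton_sup_ker {y : A} (hy : φ y ≠ 0) :
    (ℤ_[p] ∙ y).toAddSubgroup.relIndex ((ℤ_[p] ∙ y) ⊔ LinearMap.ker φ).toAddSubgroup =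
      Nat.card (LinearMap.ker φ) := by
  rw [Submodule.sup_toAddSubgroup, AddSubgroup.relIndex_sup_left, ← AddSubgroup.inf_relIndex_right]
  have h0 : (ℤ_[p] ∙ y).toAddSubgroup ⊓ (LinearMap.ker φ).toAddSubgroup = ⊥ := by
    rw [eq_bot_iff]
    rintro a ⟨ha, hk⟩
    have h : a ∈ (ℤ_[p] ∙ y) ⊓ LinearMap.ker φ := ⟨ha, hk⟩
    rw [span_singleton_inf_ker_eq_bot φ hy, Submodule.mem_bot] at h
    rw [h]
    exact AddSubgroup.zero_mem _
  rw [h0, AddSubgroup.relIndex_bot_left]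
  rfl

/-- **THE INDEX FORMULA: `#(A / ℤ_p·y) = #ker φ · p^{v(φ y) − v₀}`** for `φ(A) = p^{v₀}ℤ_p` and `φ y ≠ 0` (a finite
number iff `ker φ` is finite). [cite: Kato2004Asterisque, Thm. 14.5 and the definition of `[M : z]` (pp. 236–237), 14.17 (p. 247)] -/
theorem natCard_quotient_span_singleton_eq {y : A} (hy : φ y ≠ 0) {v₀ : ℤ}
    (hv₀ : LinearMap.range φ = Submodule.span ℤ_[p] {((p : ℚ_[p]) ^ v₀)}) :
    Nat.card (A ⧸ (ℤ_[p] ∙ y)) = Nat.card (LinearMap.ker φ) * p ^ ((φ y).valuation - v₀).toNat := by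
  have hle : (ℤ_[p] ∙ y).toAddSubgroup ≤ ((ℤ_[p] ∙ y) ⊔ LinearMap.ker φ).toAddSubgroup :=
    Submodule.toAddSubgroup_mono le_sup_left
  have h := AddSubgroup.relIndex_mul_index hle
  rw [relIndex_span_singleton_sup_ker φ hy, index_span_singleton_sup_ker φ hy hv₀] at h
  rw [h]
  rfl

/-- **`#(A / ℤ_p·y) = 0` (an infinite quotient) when `φ y = 0` but `φ b ≠ 0` for some `b`**: `c ↦ [c • b]` embeds `ℤ_p`.
[folklore] -/
theorem natCard_quotient_span_singleton_eq_zero {y b : A} (hy : φ y = 0) (hb : φ b ≠ 0) :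
    Nat.card (A ⧸ (ℤ_[p] ∙ y)) = 0 := by
  haveI : Infinite ℤ_[p] := Infinite.of_injective _ Nat.cast_injective
  haveI : Infinite (A ⧸ (ℤ_[p] ∙ y)) := by
    refine Infinite.of_injective (fun c : ℤ_[p] ↦ Submodule.Quotient.mk (p := ℤ_[p] ∙ y) (c • b)) fun c d hcd ↦ ?_
    have hcd' : c • b - d • b ∈ ℤ_[p] ∙ y := (Submodule.Quotient.eq _).mp hcd
    rw [← sub_smul, Submodule.mem_span_singleton] at hcd'
    obtain ⟨e, he⟩ := hcd'
    have h := congrArg φ he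
    rw [map_smul, map_smul, hy, smul_zero] at h
    rcases eq_zero_or_eq_zero_of_smul_eq_zero h.symm with h1 | h1
    · exact sub_eq_zero.mp h1
    · exact absurd h1 hb
  exact Nat.card_eq_zero_of_infinite

/-- If `A` is finitely generated and `φ ≠ 0` on `A`, then **`φ(A) = p^{v₀}ℤ_p` for some `v₀ ∈ ℤ`** (the non-zero finitely
generated `ℤ_p`-submodules of `ℚ_p`). [cite: SerreLocalFields1979, Ch. I §3, Prop. 5 and its proof] -/
theorem exists_range_eq_span_zpow [Module.Finite ℤ_[p] A] {b : A} (hb : φ b ≠ 0) :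
    ∃ v₀ : ℤ, LinearMap.range φ = Submodule.span ℤ_[p] {((p : ℚ_[p]) ^ v₀)} := by
  have hfg : (LinearMap.range φ).FG := by
    rw [← Submodule.map_top]
    exact Module.Finite.fg_top.map φ
  refine exists_eq_span_zpow_of_fg hfg fun h ↦ hb ?_
  have hmem := LinearMap.mem_range_self φ b
  rwa [h, Submodule.mem_bot] at hmem

/-- If every element of `ker φ` is killed by a non-zero `p`-adic integer and `A` is finitely generated, **`ker φ` is
finite** (it sits in the torsion submodule, finite by `ZpCorank.finite_torsion`). [folklore] -/
theorem finite_ker_of_forall [Module.Finite ℤ_[p] A]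
    (hker : ∀ a : A, φ a = 0 → ∃ c : ℤ_[p], c ≠ 0 ∧ c • a = 0) : Finite (LinearMap.ker φ) := by
  haveI := ZpCorank.finite_torsion p A
  refine Finite.of_injective (fun a : LinearMap.ker φ ↦
    (⟨(a : A), ?_⟩ : Submodule.torsion ℤ_[p] A)) fun a b h ↦ Subtype.ext (by simpa using congrArg Subtype.val h)
  obtain ⟨c, hc, hca⟩ := hker a (LinearMap.mem_ker.mp a.2)
  exact ⟨⟨c, mem_nonZeroDivisors_of_ne_zero hc⟩, hca⟩

end IndexCalculus

/-! ## §2 On a descent package: the Kummer-log functional is non-zero, the index of `Λ·J.ι[x]`, conjunct (ii) of COUNT -/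

section Package

variable (W : WeierstrassCurve ℚ) [W.IsElliptic] [W.IsGloballyMinimal] (p : ℕ) [Fact p.Prime]
  [ContinuousSMul ℤ_[p] (W.tateModule p)] {κ : ZpExtension ℚ p} {γ : absoluteGaloisGroup ℚ}

/-- **The Kummer-log functional on a descent package**: for `W/ℚ` globally minimal of rank `1` with `Ш[p^∞]` finite and
`J : IwasawaH2Data W p κ γ I` over a pin with `𝐇¹_Γ` finitely generated, torsion free, non-zero, there are a `ℤ_p`-linear
`φ : A → ℚ_p` on `A = integralH1 (tateRep W p) p (κ.layerSubgroup 0)` and `v₀ ∈ ℤ` with: `φ x` is THE Kummer logarithm of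
`x` for every `x ∈ A`; `ker φ` = the classes killed by a non-zero `p`-adic integer (finite); `φ ≠ 0` on `A` ((α) on the
package and Thm. 12.4 (2) give a class `proj₀ h` of infinite order, cn100's `exists_proj_zero_not_isOfFinAddOrder`); and
`φ(A) = p^{v₀}ℤ_p`. [cite: Kato2004Asterisque, §14.9 (14.9.3) (p. 240), §14.14 (14.14.1) (p. 243), Thm. 12.4 (2) (p. 221)]
[cite: BlochKato1990, Ex. 3.11] [cite: SerreLocalFields1979, Ch. I §3, Prop. 5] -/
theorem exists_kummerLog_range_eq {I : IwasawaH1Data W p κ γ} (J : IwasawaH2Data W p κ γ I)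
    [Module.Finite (IwasawaAlgebra p) I.H] [Module.IsTorsionFree (IwasawaAlgebra p) I.H] [Nontrivial I.H]
    (hrank : W.mordellWeilRank = 1) (hsha : Finite (AddCommGroup.primaryComponent W.sha p)) :
    ∃ (φ : integralH1 (tateRep W p) p (κ.layerSubgroup 0) →ₗ[ℤ_[p]] ℚ_[p]) (v₀ : ℤ),
      (∀ x : integralH1 (tateRep W p) p (κ.layerSubgroup 0),
        HasLocPKummerLog W p (layerZeroToTop W p κ (x : H1 (tateRep W p) (κ.layerSubgroup 0))) (φ x)) ∧
      (∀ x : integralH1 (tateRep W p) p (κ.layerSubgroup 0), φ x = 0 → ∃ c : ℤ_[p], c ≠ 0 ∧ c • x = 0) ∧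
      Finite (LinearMap.ker φ) ∧ (∃ b, φ b ≠ 0) ∧
      LinearMap.range φ = Submodule.span ℤ_[p] {((p : ℚ_[p]) ^ v₀)} := by
  haveI := module_finite_integralH1_layerZero W p κ
  obtain ⟨P₀, hP₀⟩ := WeierstrassCurve.exists_not_isOfFinAddOrder_of_mordellWeilRank_ne_zero W
    (by rw [hrank]; exact one_ne_zero)
  obtain ⟨φ, hφ⟩ := exists_kummerLog_linearMap W p κ hP₀
  have hker : ∀ x : integralH1 (tateRep W p) p (κ.layerSubgroup 0), φ x = 0 →
      ∃ c : ℤ_[p], c ≠ 0 ∧ c • x = 0 := by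
    intro x hx
    have h0 := hφ x
    rw [hx] at h0
    obtain ⟨c, hc, hcx⟩ := exists_smul_eq_zero_of_hasLocPKummerLog_zero W p κ hrank hsha x.2 h0
    exact ⟨c, hc, Subtype.ext hcx⟩
  -- `φ ≠ 0`: a class `proj₀ h` of infinite order ((α) from the package, 12.4 (2) from the instances)
  obtain ⟨h, hh⟩ := I.exists_proj_zero_not_isOfFinAddOrder
    (fun x hx ↦ (J.proj_zero_eq_zero_iff_mem_TSubmodule x).mp hx)
  set b : integralH1 (tateRep W p) p (κ.layerSubgroup 0) := ⟨I.proj 0 h, I.proj_mem 0 h⟩ with hb_def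
  have hb : φ b ≠ 0 := by
    intro h0
    obtain ⟨c, hc, hcb⟩ := hker b h0
    apply hh
    have hfin : IsOfFinAddOrder b := isOfFinAddOrder_of_smul_eq_zero' hc hcb
    obtain ⟨n, hn, hnb⟩ := hfin.exists_nsmul_eq_zero
    exact isOfFinAddOrder_iff_nsmul_eq_zero.mpr ⟨n, hn, by simpa [hb_def] using congrArg Subtype.val hnb⟩
  obtain ⟨v₀, hv₀⟩ := exists_range_eq_span_zpow φ hb
  exact ⟨φ, v₀, hφ, hker, finite_ker_of_forall φ hker, ⟨b, hb⟩, hv₀⟩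

omit [W.IsGloballyMinimal] in
/-- **The pin carries `Λ·J.ι[x] ⊆ J.A` to `ℤ_p·proj₀ x ⊆ A`**: `#(J.A / Λ·J.ι[x]) = #(A / ℤ_p·proj₀ x)` (`integralH1Equiv`;
`toH1 ∘ ι = proj₀`; `Λ` acts on `J.A` through the augmentation, `toH1_smul`).
[cite: Kato2004Asterisque, §14.14 (14.14.1) (p. 243) and Thm. 14.5, definition of `[M : z]` (pp. 236–237)] -/
theorem natCard_quotient_ι_eq_natCard_quotient_proj {I : IwasawaH1Data W p κ γ} (J : IwasawaH2Data W p κ γ I) (x : I.H) :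
    Nat.card (J.A ⧸ (IwasawaAlgebra p) ∙ J.ι (Submodule.Quotient.mk x)) =
      Nat.card (integralH1 (tateRep W p) p (κ.layerSubgroup 0) ⧸
        (ℤ_[p] ∙ (⟨I.proj 0 x, I.proj_mem 0 x⟩ : integralH1 (tateRep W p) p (κ.layerSubgroup 0)))) := by
  have hmap : ((IwasawaAlgebra p) ∙ J.ι (Submodule.Quotient.mk x)).toAddSubgroup.map
      (J.integralH1Equiv : J.A →+ integralH1 (tateRep W p) p (κ.layerSubgroup 0)) =
      (ℤ_[p] ∙ (⟨I.proj 0 x, I.proj_mem 0 x⟩ : integralH1 (tateRep W p) p (κ.layerSubgroup 0))).toAddSubgroup := by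
    ext y
    simp only [AddSubgroup.mem_map, Submodule.mem_toAddSubgroup, Submodule.mem_span_singleton, AddMonoidHom.coe_coe]
    constructor
    · rintro ⟨a, ⟨g, rfl⟩, rfl⟩
      refine ⟨PowerSeries.constantCoeff g, Subtype.ext ?_⟩
      rw [Submodule.coe_smul, IwasawaH2Data.coe_integralH1Equiv, J.toH1_smul, J.toH1_ι]
    · rintro ⟨c, rfl⟩
      refine ⟨(PowerSeries.C c) • J.ι (Submodule.Quotient.mk x), ⟨PowerSeries.C c, rfl⟩, Subtype.ext ?_⟩
      rw [IwasawaH2Data.coe_integralH1Equiv, J.toH1_smul, PowerSeries.constantCoeff_C, J.toH1_ι, Submodule.coe_smul]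
  exact Nat.card_congr (QuotientAddGroup.congr _ _ J.integralH1Equiv hmap).toEquiv

/-- **THE INDEX FORMULA ON A PACKAGE** (W globally minimal, rank `1`, `Ш[p^∞]` finite; `𝐇¹_Γ` f.g., torsion free, `≠ 0`): with
`φ`, `v₀` as in `exists_kummerLog_range_eq` and `s` the Kummer logarithm of `proj₀ x` — (a) if `s ≠ 0`,
`[J.A : Λ·J.ι[x]] = #ker φ · p^{v(s) − v₀}` and `v₀ ≤ v(s)`; (b) if `s = 0`, `[J.A : Λ·J.ι[x]] = 0` (infinite index).
[cite: Kato2004Asterisque, Thm. 14.5 and the definition of `[M : z]` (pp. 236–237), §14.14 (14.14.1) (p. 243)]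
[cite: BlochKato1990, Ex. 3.11] -/
theorem natCard_quotient_ι_eq {I : IwasawaH1Data W p κ γ} (J : IwasawaH2Data W p κ γ I)
    (φ : integralH1 (tateRep W p) p (κ.layerSubgroup 0) →ₗ[ℤ_[p]] ℚ_[p])
    (hφ : ∀ x : integralH1 (tateRep W p) p (κ.layerSubgroup 0),
      HasLocPKummerLog W p (layerZeroToTop W p κ (x : H1 (tateRep W p) (κ.layerSubgroup 0))) (φ x))
    (hφ0 : ∃ b, φ b ≠ 0) {v₀ : ℤ} (hv₀ : LinearMap.range φ = Submodule.span ℤ_[p] {((p : ℚ_[p]) ^ v₀)})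
    (x : I.H) {s : ℚ_[p]} (hs : HasLocPKummerLog W p (layerZeroToTop W p κ (I.proj 0 x)) s) :
    (s ≠ 0 → Nat.card (J.A ⧸ (IwasawaAlgebra p) ∙ J.ι (Submodule.Quotient.mk x)) =
        Nat.card (LinearMap.ker φ) * p ^ (s.valuation - v₀).toNat ∧ v₀ ≤ s.valuation) ∧
    (s = 0 → Nat.card (J.A ⧸ (IwasawaAlgebra p) ∙ J.ι (Submodule.Quotient.mk x)) = 0) := by
  set y : integralH1 (tateRep W p) p (κ.layerSubgroup 0) := ⟨I.proj 0 x, I.proj_mem 0 x⟩ with hy_def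
  have hsy : s = φ y := ContraCount.HasLocPKummerLog.unique W p hs (hφ y)
  rw [natCard_quotient_ι_eq_natCard_quotient_proj W p J x, hsy]
  refine ⟨fun h0 ↦ ⟨natCard_quotient_span_singleton_eq φ h0 hv₀, le_valuation_of_range_eq φ hv₀ h0⟩, fun h0 ↦ ?_⟩
  obtain ⟨b, hb⟩ := hφ0
  exact natCard_quotient_span_singleton_eq_zero φ h0 hb

/-- **CONJUNCT (ii) OF THE DISPLAY COUNT (7), PROVED on descent packages**: for `W/ℚ` globally minimal of rank `1` with
`Ш[p^∞]` finite, `J : IwasawaH2Data W p κ γ I` over a pin with `𝐇¹_Γ` finitely generated, torsion free, non-zero,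
`x ∈ 𝐇¹_Γ` and `s` the Kummer logarithm of `proj₀ x`: **`s ≠ 0 ↔ [J.A : Λ·J.ι[x]] ≠ 0`**.
[cite: Kato2004Asterisque, §14.9 (14.9.3) (p. 240), §14.14 (14.14.1) (p. 243), Prop. 14.16 (p. 244)] [cite: BlochKato1990, Ex. 3.11] -/
theorem count_ii_of_iwasawaH2Data {I : IwasawaH1Data W p κ γ} (J : IwasawaH2Data W p κ γ I)
    [Module.Finite (IwasawaAlgebra p) I.H] [Module.IsTorsionFree (IwasawaAlgebra p) I.H] [Nontrivial I.H]
    (hrank : W.mordellWeilRank = 1) (hsha : Finite (AddCommGroup.primaryComponent W.sha p))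
    (x : I.H) {s : ℚ_[p]} (hs : HasLocPKummerLog W p (layerZeroToTop W p κ (I.proj 0 x)) s) :
    s ≠ 0 ↔ Nat.card (J.A ⧸ (IwasawaAlgebra p) ∙ J.ι (Submodule.Quotient.mk x)) ≠ 0 := by
  obtain ⟨φ, v₀, hφ, -, hfin, hφ0, hv₀⟩ := exists_kummerLog_range_eq W p J hrank hsha
  obtain ⟨ha, hb⟩ := natCard_quotient_ι_eq W p J φ hφ hφ0 hv₀ x hs
  constructor
  · intro h0
    rw [(ha h0).1]
    haveI := hfin
    exact mul_ne_zero (Nat.card_pos.ne') (pow_ne_zero _ (Fact.out : p.Prime).ne_zero)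
  · intro h h0
    exact h (hb h0)

end Package

end Summit.BirchSwinnertonDyer.Rank1Residual.Additive.LocPKummer

end
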